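import Summits.CriticalPhenomena.PercolationContinuityZ3.Theses.PercSubharmonicSquare

/-!
# `Assembly` (route PercSubharmonicSquare, item stmt-CriticalPhenomena-11637)

The assembly of route `PercSubharmonicSquare` (sub-problem `PercolationContinuityZ3`):
`SubharmonicPower → ExteriorSubharmonicDecay → SubcritConnectivityVanishes →
UniformSubcritDecayCloses → PercolationContinuityZ3`.

Proof. This is exactly the route's deciding theorem `closes` (route file, sorry-free): take
`s, R` from `SubharmonicPower`, `b, C` from `ExteriorSubharmonicDecay R`; for `p < p_c` the
function `u := τ_p(0,·)^s` takes values in `[0,1]`, tends to `0` cofinitely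
(`SubcritConnectivityVanishes` and continuity of `t ↦ t^s` at `0`) and is subharmonic off `Λ_R`,
so the exterior maximum principle gives `τ_p(0,x) ≤ (max C 0)^{1/s} ‖x‖^{-b/s}` uniformly in
`p < p_c`, and `UniformSubcritDecayCloses` (exponent `b/s > 0`) yields `θ(p_c) = 0` on `ℤ³`.
-/

namespace Summit.CriticalPhenomena.PercolationContinuityZ3.Theorems

/-- **Assembly of route PercSubharmonicSquare** (settles `stmt-CriticalPhenomena-11637`, exact
signature): `SubharmonicPower → ExteriorSubharmonicDecay → SubcritConnectivityVanishes →
UniformSubcritDecayCloses → PercolationContinuityZ3`. Pure logic: the four hypotheses are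
precisely those of the route's deciding theorem
`Summit.CriticalPhenomena.PercolationContinuityZ3.Theses.PercSubharmonicSquare.closes`
(uniform subcritical power decay of `τ_p` from lattice subharmonicity of `τ_p^s` off a box plus
the exterior maximum principle on `ℤ³`, closed by left-continuity at `p_c` and `τ ≥ θ²`).
[folklore] -/
theorem percSubharmonicSquare_assembly_proof :
    Summit.CriticalPhenomena.PercolationContinuityZ3.Theses.PercSubharmonicSquare.Assembly := by
  unfold Summit.CriticalPhenomena.PercolationContinuityZ3.Theses.PercSubharmonicSquare.Assembly
  intro hS hE hV hC
  exact Summit.CriticalPhenomena.PercolationContinuityZ3.Theses.PercSubharmonicSquare.closes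
    hS hE hV hC

end Summit.CriticalPhenomena.PercolationContinuityZ3.Theorems
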